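import Summits.ABC.StewartYu.PadicG3SatNSizesB
import Summits.ABC.StewartYu.PadicG3HalfSlots
import Summits.ABC.StewartYu.PadicG3VbHalfLine
import Literature.NumberTheory.Transcendental.PiTranscendenceMeasureMain
import HarnessLib

/-!
# Cell abc-stewartyu, WP-L.P(odd) (crux r3 `PadicCoreOddRat`, stmt-ABC-20503): the HALF-STEP THRESHOLD of the saturated pack on `schedN b`
# in closed log-linear form (budget-parametric)

`Summits/ABC/StewartYu/PadicG3SatNHalfSizes.lean` — cell `abc-stewartyu` (seat p2-g6, pack twin step 4; record owner p1 g10; R28(d)/R31(a)).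
Proofs only; no definition, no named fact.  Twin of the SIZE half of `PadicG3VbHalfLine.half_threshold_log_le` (p3-g7) for `F : S.SatData`
with the VIRTUAL half denominator `Dh` inside `DCsat`/`MhCsat` (cell file `PadicG3SatSupply`):

* `log_DCsat_N_le`: `log DCsat(Lb svS lev, HV, s₁, τ) ≤ τ.1·(23/20)HV + |t|·W + log Dh`;
* `log_Dh_half_N_le`: at a half point `|s₁| ≤ 2·NhS(lev+1) − 1`, `log Dh(Lb svS lev, s₁) ≤ 2·htsV 0 + (n+2)·ΣA`;
* `log_half_threshold_N_le`: with the abstract majorants `T0r ≥ TordS 0 0`, `cX ≥` the directional log, `Thr ≥ TordS lev n − tS lev`: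
  `log(4·DCsat²·(1 + UcardSat·PmaxSat·MhCsat)·heightProd(θ)³) ≤ 6 log 2 + 2ℓU + T0r·(ŜN log 2 + (23/20)HV + cX) + 2·HV/e
   + 2·L0N(ŜN+n+6) log 2 + 8·htsV 0 + Thr·(ŜN log 2 + log 2 + (69/20)HV + 2W + cX) + (6n+10)·ΣA`.

WHAT THIS IS NOT: the comparison with `Zp` (p1's atoms); no crux moves.

References: Yu. V. Nesterenko, LNM 1819 (2003) §4.3 (4.39)–(4.45); K. Yu, Acta Math. 211 (2013) §6.
-/

noncomputable section

open Finset Real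
open Literature.NumberTheory.Transcendental
open Literature.NumberTheory.Transcendental.CW77.Setup (Tau tauNorm)

namespace Summit.ABC.StewartYu

namespace G3Setup

variable {p : ℕ} [Fact p.Prime] (S : G3Setup p) (F : S.SatData) (P : PadicG3ParN S.n) (b : ℝ)

/-- `log DCsat(Bv, HV, s₁, τ) ≤ τ.1·(23/20)·HV + |t|·W + log Dh(Bv, s₁)` (`ψ(H) ≤ 1.15 H`, `log|b̃_{k₀}| ≤ W`).
[cite: Nesterenko2003, (3.26); shape only] -/
theorem log_DCsat_N_le (hbW : ∀ j, Real.log (max 3 (|S.b j| : ℝ)) ≤ P.W) (Bv : Fin S.n → ℕ) (s₁ : ℤ) (τ : Tau S.n) :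
    Real.log (S.DCsat F Bv P.HV s₁ τ : ℝ) ≤ τ.1 * (23 / 20 * P.HV) + ((∑ k, τ.2 k : ℕ) : ℝ) * P.W + Real.log (F.Dh Bv s₁ : ℝ) := by
  rw [S.log_DCsat_eq F Bv P.HV s₁ τ]
  have hν := NWPi.log_lcmUpto_le P.HV
  have hbW' := S.log_abs_bj₀_le hbW
  have ht1 : (0 : ℝ) ≤ τ.1 := Nat.cast_nonneg _
  have ht2 : (0 : ℝ) ≤ ((∑ k, τ.2 k : ℕ) : ℝ) := Nat.cast_nonneg _
  nlinarith [mul_le_mul_of_nonneg_left hν ht1, mul_le_mul_of_nonneg_left hbW' ht2]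

/-- **The half denominator at a half point**: `log Dh(Lb svS lev, s₁) ≤ 2·htsV 0 + (n+2)·ΣA` for `|s₁| ≤ 2·NhS (lev+1) − 1`.
[cite: Nesterenko2003, §3.2; shape only] -/
theorem log_Dh_half_N_le (hb : 1 ≤ b) (hαA : ∀ j, Height.logHeight₁ (F.αo j) ≤ P.A j) (hUcol : ∀ j, (F.Ucol j : ℤ) ≤ S.n * F.N)
    (lev : ℕ) {s₁ : ℤ} (hs : |s₁| ≤ (2 * (S.NhS (P.schedN b) (lev + 1) : ℤ) - 1 : ℤ)) :
    Real.log (F.Dh (S.Lb (S.svS F (P.schedN b)) lev) s₁ : ℝ) ≤ 2 * P.htsV 0 + (S.n + 2) * ∑ j, P.A j := by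
  have h1 := S.log_Dh_N_le F P b hb hαA hUcol lev s₁
  have h2 := S.abs_half_mul_le P b lev hs
  have h3 : (2 * P.g * P.XV + 1) * (S.n * P.LV) ≤ 2 * P.htsV 0 := by
    unfold PadicG3Par.htsV
    have hg : 0 ≤ P.g := le_trans zero_le_one P.one_le_g
    have hXV : (0 : ℝ) ≤ P.XV := by positivity
    have hnL : (0 : ℝ) ≤ S.n * P.LV := by positivity
    simp only [pow_zero, one_mul]
    nlinarith
  linarith

set_option maxHeartbeats 400000 in
/-- **THE HALF-STEP THRESHOLD OF THE SATURATED PACK, PER DEGREE, IN CLOSED FORM** (budget-parametric in `T0r`, `cX`, `Thr`).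
[cite: Nesterenko2003, §4.3 (4.39)–(4.44); shape only] -/
theorem log_half_threshold_N_le (hb : 1 ≤ b) (hn : 1 ≤ S.n) (hA1 : ∀ j, 1 ≤ P.A j) (hαA : ∀ j, Height.logHeight₁ (F.αo j) ≤ P.A j)
    (hbW : ∀ j, Real.log (max 3 (|S.b j| : ℝ)) ≤ P.W) (hC : ∀ j k, |F.C j k| ≤ ((S.n.factorial * F.N : ℕ) : ℤ))
    (hUcol : ∀ j, (F.Ucol j : ℤ) ≤ S.n * F.N) (hθA : ∀ i, Height.logHeight₁ (S.α i) ≤ ∑ j, P.A j)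
    {T0r : ℝ} (hT0 : (S.TordS (P.schedN b) 0 0 : ℝ) ≤ T0r) {cX : ℝ}
    (hcX : Real.log 2 + 3 * Real.log S.n + Real.log S.n.factorial + Real.log F.N + P.W + Real.log P.LV ≤ cX)
    {Thr : ℝ} {lev : ℕ} (hTh : ((S.TordS (P.schedN b) lev S.n - S.tS (P.schedN b) lev : ℕ) : ℝ) ≤ Thr)
    (hlev : lev < P.SdN) {s₁ : ℤ} (hs : |s₁| ≤ (2 * (S.NhS (P.schedN b) (lev + 1) : ℤ) - 1 : ℤ))
    (τ : Tau S.n) (hτ : tauNorm τ + S.tS (P.schedN b) lev ≤ S.TordS (P.schedN b) lev S.n) :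
    Real.log (4 * (S.DCsat F (S.Lb (S.svS F (P.schedN b)) lev) P.HV s₁ τ : ℝ) ^ 2 *
        (1 + (S.UcardSat F (P.schedN b) : ℝ) * (S.PmaxSat F (P.schedN b)) *
          S.MhCsat F (S.Lb (S.LcS F (P.schedN b)) lev) (S.Lb (S.svS F (P.schedN b)) lev) P.L0N P.HV P.SdN lev s₁ τ) *
        CW77.heightProd S.α ^ 3) ≤
      6 * Real.log 2 + 2 * (Real.log ((P.L0N : ℝ) + 1) + S.n * Real.log (S.n * S.n.factorial * F.N * P.LV + 1)) +
      T0r * (P.SdN * Real.log 2 + 23 / 20 * P.HV + cX) + 2 * (P.HV / Real.exp 1) + 2 * (P.L0N * ((P.SdN + S.n + 6) * Real.log 2)) +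
      8 * P.htsV 0 + Thr * (P.SdN * Real.log 2 + Real.log 2 + 69 / 20 * P.HV + 2 * P.W + cX) + (6 * S.n + 10) * ∑ j, P.A j := by
  have hcX0 := S.cX_nonneg F P hn hcX
  -- abbreviations
  set Bv := S.Lb (S.svS F (P.schedN b)) lev with hBv
  set Lc := S.Lb (S.LcS F (P.schedN b)) lev with hLc
  set U := S.UcardSat F (P.schedN b) with hUdef
  set Pm := S.PmaxSat F (P.schedN b) with hPm
  have hU1 : 1 ≤ U := S.one_le_UcardSat F (P.schedN b)
  obtain ⟨hP1r, _⟩ := S.PmaxSat_le_two_mul F (P.schedN b)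
  have hP1 : (1 : ℤ) ≤ Pm := by exact_mod_cast hP1r
  have hD1 : (1 : ℝ) ≤ (S.DCsat F Bv P.HV s₁ τ : ℝ) := by exact_mod_cast S.one_le_DCsat F Bv P.HV s₁ τ
  have hQ0 := S.MhCsat_nonneg F Lc Bv P.L0N P.HV P.SdN lev s₁ τ
  have hHp1 := CW77.one_le_heightProd S.α
  have hP0 : (0 : ℝ) ≤ (Pm : ℝ) := le_trans zero_le_one hP1r
  -- (i) DCsat
  have hDC := S.log_DCsat_N_le F P hbW Bv s₁ τ
  -- (ii) 1 + U·P·MhCsat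
  have hQ := S.log_one_add_UPMhCsat_le F hU1 hP1 Lc Bv P.L0N P.HV P.SdN lev s₁ τ
  have hUl : Real.log (U : ℝ) ≤ Real.log ((P.L0N : ℝ) + 1) + S.n * Real.log (S.n * S.n.factorial * F.N * P.LV + 1) :=
    S.log_UcardSat_N_le F P b hb hA1 hC
  have hPl := S.log_PmaxSat_N_le F P b hb hn hA1 hαA hbW hC hT0 hcX
  have hs' : (|s₁| : ℝ) ≤ 2 ^ ((lev + 1) + S.n) * (9 * P.HV) := by
    have h1 : ((|s₁| : ℤ) : ℝ) ≤ ((2 * (S.NhS (P.schedN b) (lev + 1) : ℤ) - 1 : ℤ) : ℝ) := by exact_mod_cast hs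
    have h2 := S.halfNodes_N_le_HV P b hn lev
    push_cast at h1 h2 ⊢
    linarith only [h1, h2]
  have hM := log_M0C_le_sharp P.L0N P.HV P.SdN (lev + 1) s₁ τ.1
  have hL := S.L0_factor_N_le P (by omega : lev + 1 ≤ P.SdN) hs'
  have hS : ((P.SdN - (lev + 1) : ℕ) : ℝ) ≤ P.SdN := by exact_mod_cast Nat.sub_le _ _
  have hXl := S.log_max_one_XbC_LcS_N_le F P b hb hn hA1 hbW hC hcX lev
  -- (iii) Dh and heights
  have hDh := S.log_Dh_half_N_le F P b hb hαA hUcol lev hs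
  have hHp : Real.log (CW77.heightProd S.α) ≤ S.n * ∑ j, P.A j := by
    have h := S.log_heightProd_le_of_le (V := fun _ => ∑ j, P.A j) hθA
    simpa [Finset.sum_const, Finset.card_univ, Fintype.card_fin, nsmul_eq_mul] using h
  -- (iv) the order budget of the target
  have hτr : ((τ.1 : ℝ) + ((∑ k, τ.2 k : ℕ) : ℝ)) ≤ Thr := by
    have h1 : tauNorm τ ≤ S.TordS (P.schedN b) lev S.n - S.tS (P.schedN b) lev := by omega
    have h2 : ((tauNorm τ : ℕ) : ℝ) ≤ ((S.TordS (P.schedN b) lev S.n - S.tS (P.schedN b) lev : ℕ) : ℝ) := by exact_mod_cast h1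
    unfold tauNorm at h2; rw [Nat.cast_add] at h2
    exact h2.trans hTh
  have ht1 : (0 : ℝ) ≤ τ.1 := Nat.cast_nonneg _
  have ht2 : (0 : ℝ) ≤ ((∑ k, τ.2 k : ℕ) : ℝ) := Nat.cast_nonneg _
  have hl2 : 0 ≤ Real.log 2 := Real.log_nonneg (by norm_num)
  have hHV : (0 : ℝ) ≤ P.HV := by positivity
  have hW0 : 0 ≤ P.W := le_trans zero_le_one P.hW
  have hSd : (0 : ℝ) ≤ P.SdN * Real.log 2 := by positivity
  have hc0 : (0 : ℝ) ≤ P.SdN * Real.log 2 + Real.log 2 + 69 / 20 * P.HV + 2 * P.W + cX := by positivity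
  have hτsum : (τ.1 : ℝ) * (P.SdN * Real.log 2 + Real.log 2 + 69 / 20 * P.HV) + ((∑ k, τ.2 k : ℕ) : ℝ) * (2 * P.W + cX) ≤
      Thr * (P.SdN * Real.log 2 + Real.log 2 + 69 / 20 * P.HV + 2 * P.W + cX) := by
    calc (τ.1 : ℝ) * (P.SdN * Real.log 2 + Real.log 2 + 69 / 20 * P.HV) + ((∑ k, τ.2 k : ℕ) : ℝ) * (2 * P.W + cX)
        ≤ τ.1 * (P.SdN * Real.log 2 + Real.log 2 + 69 / 20 * P.HV + 2 * P.W + cX) +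
          ((∑ k, τ.2 k : ℕ) : ℝ) * (P.SdN * Real.log 2 + Real.log 2 + 69 / 20 * P.HV + 2 * P.W + cX) :=
          add_le_add (mul_le_mul_of_nonneg_left (by linarith only [hW0, hcX0]) ht1)
            (mul_le_mul_of_nonneg_left (by linarith only [hSd, hl2, hHV]) ht2)
      _ = ((τ.1 : ℝ) + ((∑ k, τ.2 k : ℕ) : ℝ)) * (P.SdN * Real.log 2 + Real.log 2 + 69 / 20 * P.HV + 2 * P.W + cX) := by ring
      _ ≤ _ := mul_le_mul_of_nonneg_right hτr hc0
  -- M0C at the half node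
  have hMl : Real.log (M0C P.L0N P.HV P.SdN (lev + 1) s₁ τ.1 : ℝ) ≤
      Real.log 2 + τ.1 * (P.SdN * Real.log 2 + 23 / 20 * P.HV) + P.HV / Real.exp 1 + P.L0N * ((P.SdN + S.n + 6) * Real.log 2) := by
    nlinarith [mul_le_mul_of_nonneg_right hS (mul_nonneg ht1 hl2), hM, hL]
  have hXt : ((∑ k, τ.2 k : ℕ) : ℝ) * Real.log (max 1 (S.XbC Lc : ℝ)) ≤ ((∑ k, τ.2 k : ℕ) : ℝ) * cX :=
    mul_le_mul_of_nonneg_left hXl ht2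
  -- (v) assemble
  have hQpos : 0 < 1 + (U : ℝ) * Pm * S.MhCsat F Lc Bv P.L0N P.HV P.SdN lev s₁ τ := by positivity
  have hMprod : Real.log (4 * (S.DCsat F Bv P.HV s₁ τ : ℝ) ^ 2 * (1 + (U : ℝ) * Pm * S.MhCsat F Lc Bv P.L0N P.HV P.SdN lev s₁ τ) *
        CW77.heightProd S.α ^ 3) =
      Real.log 4 + 2 * Real.log (S.DCsat F Bv P.HV s₁ τ : ℝ) + Real.log (1 + (U : ℝ) * Pm * S.MhCsat F Lc Bv P.L0N P.HV P.SdN lev s₁ τ) +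
        3 * Real.log (CW77.heightProd S.α) := by
    rw [Real.log_mul (by positivity) (by positivity), Real.log_mul (by positivity) hQpos.ne',
      Real.log_mul (by norm_num) (by positivity), Real.log_pow, Real.log_pow]
    push_cast; ring
  rw [hMprod]
  have hl4 : Real.log 4 = 2 * Real.log 2 := by
    rw [show (4 : ℝ) = 2 ^ 2 by norm_num, Real.log_pow]; norm_num
  rw [hl4]
  linarith only [hDC, hQ, hUl, hPl, hMl, hXt, hDh, hHp, hτsum]

end G3Setup

end Summit.ABC.StewartYu

end
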